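import Mathlib
import Summits.AtomisticToContinuum.FouriersLaw.Theorems.CageBudgetFeketeHeatVarianceCalculusLaplace
import HarnessLib

/-!
# Crux `FibreCalculus` (stmt-AtomisticToContinuum-16011), line `Sketch` (canonical reduction):
stub `stub_conservationLawIdentities` — the `k`-space conservation law and the Helfand–Abel identity

PURE REAL ANALYSIS. For arbitrary `S G : ℤ → ℝ → ℝ` with `G(x,·)` continuous, `|G| ≤ M`,
`Σ_x (1+x²)|G(x,t)| ≤ A(1+|t|)^m`, the twice-integrated local conservation law
`S(x,t) − S(x,0) = ∫_{(0,t]}(t−u)(G(x+1,u) − 2G(x,u) + G(x−1,u))du` (`t ≥ 0`), Laplace-integrable `S(x,·)` and the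
weighted summabilities of `S̄_ν = ν∫₀^∞e^{-νt}S(·,t)dt` and `S(·,0)`, we prove
(11) `χ(k) − f̂_ν(k) = (2 − 2cos k) 𝒢_ν(k)/ν` and (12) `∫₀^∞ e^{−νt} Σ_x G(x,t) dt = (ν/2)(Σ_x x²S̄_ν(x) − Σ_x x²S(x,0))`.
Route: the Laplace calculus of `V(t) = ∫_{(0,t]}(t−u)F(u)du` (`∫e^{−νt}V = ν⁻²∫e^{−νt}F`, from
`Theorems/CageBudgetFeketeHeatVarianceCalculusLaplace.lean`) gives the POINTWISE ABEL LAW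
`S̄_ν(x) − S(x,0) = ν⁻¹(L(x+1) − 2L(x) + L(x−1))`, `L(x) = ∫₀^∞e^{−νt}G(x,t)dt`, `Σ_x (1+x²)|L(x)| < ∞`; its cosine
transform is (11) (summation by parts on `ℤ`; `𝒢_ν(k) = Σ_x cos(kx)L(x)` by `integral_tsum_of_summable_integral_norm`),
its `x²`-moment is (12). References: E. Helfand, Phys. Rev. 119 (1960) 1–9; Bonetto–Lebowitz–Rey-Bellet (2000) §7.
-/

noncomputable section

namespace Summit.AtomisticToContinuum.FouriersLaw.Theorems.FibreCalculusSketch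

open MeasureTheory ProbabilityTheory Filter Topology Set Function
open Summit.AtomisticToContinuum.FouriersLaw.Theorems.HeatVarianceCalculus.CanonicalRigidity

/-! ## Laplace calculus -/

/-- Laplace transform of a doubly integrated function: for continuous bounded `F` and
`V(t) = ∫_{(0,t]}(t-u)F(u)du`, `e^{-νt}F, e^{-νt}V ∈ L¹(0,∞)` and `∫₀^∞e^{-νt}V = ν⁻²∫₀^∞e^{-νt}F`. [folklore] -/
theorem cli_laplace_twiceIntegrated {F : ℝ → ℝ} (hF : Continuous F) {M : ℝ} (hM : ∀ t : ℝ, |F t| ≤ M)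
    {ν : ℝ} (hν : 0 < ν) :
    IntegrableOn (fun t : ℝ => Real.exp (-(ν * t)) * F t) (Ioi 0) ∧
    IntegrableOn (fun t : ℝ => Real.exp (-(ν * t)) * ∫ u in Ioc (0:ℝ) t, (t - u) * F u) (Ioi 0) ∧
    ∫ t in Ioi (0:ℝ), Real.exp (-(ν * t)) * ∫ u in Ioc (0:ℝ) t, (t - u) * F u =
      (ν ^ 2)⁻¹ * ∫ t in Ioi (0:ℝ), Real.exp (-(ν * t)) * F t := by
  obtain ⟨h1, h2, h3⟩ := stub_laplaceHeatVariance F hF ⟨M, hM⟩ _ rfl ν hν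
  have hν0 : ν ≠ 0 := hν.ne'
  have h4 : ∫ t in Ioi (0:ℝ), Real.exp (-(ν * t)) * (2 * ∫ u in Ioc (0:ℝ) t, (t - u) * F u) =
      2 * ∫ t in Ioi (0:ℝ), Real.exp (-(ν * t)) * ∫ u in Ioc (0:ℝ) t, (t - u) * F u := by
    rw [← integral_const_mul]
    refine integral_congr_ae (Eventually.of_forall fun t => ?_)
    ring
  have h3' : ∫ t in Ioi (0:ℝ), Real.exp (-(ν * t)) * F t = ν ^ 2 / 2 *
      ∫ t in Ioi (0:ℝ), Real.exp (-(ν * t)) * (2 * ∫ u in Ioc (0:ℝ) t, (t - u) * F u) := h3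
  rw [h4] at h3'
  refine ⟨h1, IntegrableOn.congr_fun (h2.const_mul (2:ℝ)⁻¹) (fun t _ => ?_) measurableSet_Ioi, ?_⟩
  · ring
  · rw [h3']
    field_simp

/-- `∫₀^∞ e^{-νt} dt = ν⁻¹` (`ν > 0`). [folklore] -/
theorem cli_integral_exp_neg_mul_Ioi {ν : ℝ} (hν : 0 < ν) :
    ∫ t in Ioi (0:ℝ), Real.exp (-(ν * t)) = ν⁻¹ := by
  have h := integral_exp_mul_Ioi (a := -ν) (by linarith) 0
  simp only [mul_zero, Real.exp_zero, neg_mul] at h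
  rw [h]
  field_simp

/-- `e^{-νt}(1+t)^m` is integrable on `(0, ∞)` (`ν > 0`). [folklore] -/
theorem cli_integrableOn_exp_neg_mul_one_add_pow {ν : ℝ} (hν : 0 < ν) (m : ℕ) :
    IntegrableOn (fun t : ℝ => Real.exp (-(ν * t)) * (1 + t) ^ m) (Ioi 0) := by
  have e : (fun t : ℝ => Real.exp (-(ν * t)) * (1 + t) ^ m) =
      fun t => ∑ j ∈ Finset.range (m + 1), Real.exp (-(ν * t)) * ((m.choose j : ℝ) * t ^ j) := by
    funext t
    rw [add_comm, add_pow, Finset.mul_sum]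
    exact Finset.sum_congr rfl fun j _ => by rw [one_pow, mul_one, mul_comm (t ^ j)]
  rw [e]
  exact integrable_finsetSum _ fun j _ => integrableOn_exp_neg_mul_of_abs_le_pow (by fun_prop)
    (K := (m.choose j : ℝ)) (n := j) (fun t ht => by rw [abs_mul, abs_pow, abs_of_nonneg ht, Nat.abs_cast]) hν

/-! ## The pointwise Abel law -/

/-- POINTWISE ABEL LAW: from the twice-integrated conservation law,
`ν∫₀^∞e^{-νt}S(x,t)dt − S(x,0) = ν⁻¹(L(x+1) − 2L(x) + L(x−1))`, `L(y) = ∫₀^∞e^{-νt}G(y,t)dt`. [folklore] -/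
theorem cli_abel_pointwise {S G : ℤ → ℝ → ℝ} (hGc : ∀ x : ℤ, Continuous (G x)) {M : ℝ}
    (hM : ∀ (x : ℤ) (t : ℝ), |G x t| ≤ M)
    (hS : ∀ (x : ℤ) (t : ℝ), 0 ≤ t →
      S x t - S x 0 = ∫ u in Set.Ioc (0:ℝ) t, (t - u) * (G (x + 1) u - 2 * G x u + G (x - 1) u))
    {ν : ℝ} (hν : 0 < ν) (x : ℤ) :
    ν * (∫ t in Ioi (0:ℝ), Real.exp (-(ν * t)) * S x t) - S x 0 =
      ν⁻¹ * ((∫ t in Ioi (0:ℝ), Real.exp (-(ν * t)) * G (x + 1) t)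
        - 2 * (∫ t in Ioi (0:ℝ), Real.exp (-(ν * t)) * G x t)
        + ∫ t in Ioi (0:ℝ), Real.exp (-(ν * t)) * G (x - 1) t) := by
  have hν0 : ν ≠ 0 := hν.ne'
  have hFc : Continuous fun u : ℝ => G (x + 1) u - 2 * G x u + G (x - 1) u := by
    have := hGc (x + 1); have := hGc x; have := hGc (x - 1); fun_prop
  have hFb : ∀ t : ℝ, |G (x + 1) t - 2 * G x t + G (x - 1) t| ≤ 4 * M := fun t => by
    have h1 := abs_le.1 (hM (x + 1) t); have h2 := abs_le.1 (hM x t); have h3 := abs_le.1 (hM (x - 1) t)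
    exact abs_le.2 ⟨by linarith [h1.1, h2.2, h3.1], by linarith [h1.2, h2.1, h3.2]⟩
  obtain ⟨-, hiV, hlap⟩ := cli_laplace_twiceIntegrated hFc hFb hν
  have hI : ∀ y : ℤ, IntegrableOn (fun t : ℝ => Real.exp (-(ν * t)) * G y t) (Ioi 0) := fun y =>
    integrableOn_exp_neg_mul_of_abs_le_pow (hGc y) (K := M) (n := 0) (fun t _ => by simpa using hM y t) hν
  have hIe : IntegrableOn (fun t : ℝ => Real.exp (-(ν * t))) (Ioi 0) := by
    simpa using integrableOn_exp_neg_mul_of_abs_le_pow (g := fun _ => (1:ℝ)) continuous_const (K := 1)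
      (n := 0) (fun t _ => by simp) hν
  have hEq : EqOn (fun t : ℝ => Real.exp (-(ν * t)) * S x t)
      (fun t : ℝ => S x 0 * Real.exp (-(ν * t)) + Real.exp (-(ν * t)) *
        ∫ u in Ioc (0:ℝ) t, (t - u) * (G (x + 1) u - 2 * G x u + G (x - 1) u)) (Ioi 0) := fun t ht => by
    simp only
    rw [← hS x t (le_of_lt ht)]
    ring
  have h1 : ∫ t in Ioi (0:ℝ), Real.exp (-(ν * t)) * S x t = S x 0 * ν⁻¹ + (ν ^ 2)⁻¹ *
      ∫ t in Ioi (0:ℝ), Real.exp (-(ν * t)) * (G (x + 1) t - 2 * G x t + G (x - 1) t) := by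
    rw [setIntegral_congr_fun measurableSet_Ioi hEq, integral_add (hIe.const_mul _) hiV,
      integral_const_mul, cli_integral_exp_neg_mul_Ioi hν, hlap]
  have h2 : ∫ t in Ioi (0:ℝ), Real.exp (-(ν * t)) * (G (x + 1) t - 2 * G x t + G (x - 1) t) =
      (∫ t in Ioi (0:ℝ), Real.exp (-(ν * t)) * G (x + 1) t)
        - 2 * (∫ t in Ioi (0:ℝ), Real.exp (-(ν * t)) * G x t)
        + ∫ t in Ioi (0:ℝ), Real.exp (-(ν * t)) * G (x - 1) t := by
    have e : (fun t : ℝ => Real.exp (-(ν * t)) * (G (x + 1) t - 2 * G x t + G (x - 1) t)) = fun t =>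
        Real.exp (-(ν * t)) * G (x + 1) t - 2 * (Real.exp (-(ν * t)) * G x t)
          + Real.exp (-(ν * t)) * G (x - 1) t := by
      funext t; ring
    rw [e, integral_add, integral_sub (hI (x + 1)) ((hI x).const_mul 2), integral_const_mul]
    · exact (hI (x + 1)).sub ((hI x).const_mul 2)
    · exact hI (x - 1)
  rw [h1, h2]
  field_simp
  ring

/-! ## Lattice sums -/

/-- Summation by parts on `ℤ` for the lattice Laplacian:
`Σ_x w(x)(a(x+1) - 2a(x) + a(x-1)) = Σ_x (w(x-1) - 2w(x) + w(x+1)) a(x)`. [folklore] -/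
theorem cli_tsum_mul_laplacian (w a : ℤ → ℝ)
    (h1 : Summable fun x : ℤ => w x * a (x + 1)) (h0 : Summable fun x : ℤ => w x * a x)
    (h2 : Summable fun x : ℤ => w x * a (x - 1)) :
    ∑' x : ℤ, w x * (a (x + 1) - 2 * a x + a (x - 1)) =
      ∑' x : ℤ, (w (x - 1) - 2 * w x + w (x + 1)) * a x := by
  have e1 : ∑' x : ℤ, w x * a (x + 1) = ∑' x : ℤ, w (x - 1) * a x := by
    rw [← (Equiv.subRight (1:ℤ)).tsum_eq (fun x : ℤ => w x * a (x + 1))]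
    exact tsum_congr fun x => by simp
  have e2 : ∑' x : ℤ, w x * a (x - 1) = ∑' x : ℤ, w (x + 1) * a x := by
    rw [← (Equiv.addRight (1:ℤ)).tsum_eq (fun x : ℤ => w x * a (x - 1))]
    exact tsum_congr fun x => by simp
  have h1' : Summable fun x : ℤ => w (x - 1) * a x :=
    ((Equiv.subRight (1:ℤ)).summable_iff.mpr h1).congr fun x => by simp
  have h2' : Summable fun x : ℤ => w (x + 1) * a x :=
    ((Equiv.addRight (1:ℤ)).summable_iff.mpr h2).congr fun x => by simp
  have h02 : Summable fun x : ℤ => 2 * (w x * a x) := h0.mul_left 2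
  calc ∑' x : ℤ, w x * (a (x + 1) - 2 * a x + a (x - 1))
      = ∑' x : ℤ, (w x * a (x + 1) - 2 * (w x * a x) + w x * a (x - 1)) := tsum_congr fun x => by ring
    _ = (∑' x : ℤ, w x * a (x + 1)) - (∑' x : ℤ, 2 * (w x * a x)) + ∑' x : ℤ, w x * a (x - 1) := by
        rw [(h1.sub h02).tsum_add h2, h1.tsum_sub h02]
    _ = (∑' x : ℤ, w (x - 1) * a x) - (∑' x : ℤ, 2 * (w x * a x)) + ∑' x : ℤ, w (x + 1) * a x := by
        rw [e1, e2]
    _ = ∑' x : ℤ, (w (x - 1) * a x - 2 * (w x * a x) + w (x + 1) * a x) := by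
        rw [(h1'.sub h02).tsum_add h2', h1'.tsum_sub h02]
    _ = ∑' x : ℤ, (w (x - 1) - 2 * w x + w (x + 1)) * a x := tsum_congr fun x => by ring

/-- Weighted comparison: `Σ_x (1+x²)|L(x)| < ∞` and `|c(x)| ≤ B(1+(e x)²)` give `Σ_x c(x)L(e x)` absolutely
summable, for a bijection `e` of `ℤ`. [folklore] -/
theorem cli_summable_mul_shift {L c : ℤ → ℝ} (hL : Summable fun x : ℤ => (1 + (x : ℝ) ^ 2) * |L x|)
    (e : ℤ ≃ ℤ) (B : ℝ) (hc : ∀ x : ℤ, |c x| ≤ B * (1 + ((e x : ℤ) : ℝ) ^ 2)) :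
    Summable fun x : ℤ => c x * L (e x) :=
  Summable.of_norm_bounded ((e.summable_iff.mpr hL).mul_left B) fun x => by
    rw [Real.norm_eq_abs, abs_mul]
    simp only [Function.comp_apply]
    rw [← mul_assoc]
    exact mul_le_mul_of_nonneg_right (hc x) (abs_nonneg _)

/-- `cos(k(y-1)) + cos(k(y+1)) = 2 cos k · cos(ky)`. [folklore] -/
theorem cli_cos_shift_add (k y : ℝ) :
    Real.cos (k * (y - 1)) + Real.cos (k * (y + 1)) = 2 * Real.cos k * Real.cos (k * y) := by
  rw [mul_sub, mul_add, mul_one, Real.cos_sub, Real.cos_add]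
  ring

/-! ## Weighted Laplace transforms of the lattice family `G` -/

/-- For `G(x,·)` continuous, `|G| ≤ M`, `Σ_x (1+x²)|G(x,t)| ≤ A(1+|t|)^m`, `ν > 0` and
`L(x) = ∫₀^∞ e^{-νt}G(x,t)dt`: `Σ_x (1+x²)|L(x)| < ∞`, and for `|c_x| ≤ 1` the exchange
`∫₀^∞ e^{-νt} Σ_x c_x G(x,t) dt = Σ_x c_x L(x)`. [folklore] -/
theorem cli_laplace_family {G : ℤ → ℝ → ℝ} (hGc : ∀ x : ℤ, Continuous (G x)) {M : ℝ}
    (hGb : ∀ (x : ℤ) (t : ℝ), |G x t| ≤ M) {A : ℝ} {m : ℕ}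
    (hGw : ∀ t : ℝ, Summable (fun x : ℤ => (1 + (x : ℝ) ^ 2) * |G x t|) ∧
      (∑' x : ℤ, (1 + (x : ℝ) ^ 2) * |G x t|) ≤ A * (1 + |t|) ^ m)
    {ν : ℝ} (hν : 0 < ν) :
    (Summable fun x : ℤ => (1 + (x : ℝ) ^ 2) * |∫ t in Ioi (0:ℝ), Real.exp (-(ν * t)) * G x t|) ∧
    ∀ c : ℤ → ℝ, (∀ x : ℤ, |c x| ≤ 1) →
      ∫ t in Ioi (0:ℝ), Real.exp (-(ν * t)) * ∑' x : ℤ, c x * G x t =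
        ∑' x : ℤ, c x * ∫ t in Ioi (0:ℝ), Real.exp (-(ν * t)) * G x t := by
  have hI : ∀ x : ℤ, IntegrableOn (fun t : ℝ => Real.exp (-(ν * t)) * G x t) (Ioi 0) := fun x =>
    integrableOn_exp_neg_mul_of_abs_le_pow (hGc x) (K := M) (n := 0) (fun t _ => by simpa using hGb x t) hν
  have hIa : ∀ x : ℤ, IntegrableOn (fun t : ℝ => Real.exp (-(ν * t)) * |G x t|) (Ioi 0) := fun x =>
    integrableOn_exp_neg_mul_of_abs_le_pow (continuous_abs.comp (hGc x)) (K := M) (n := 0)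
      (fun t _ => by simpa [abs_abs] using hGb x t) hν
  have hnn : ∀ x : ℤ, 0 ≤ ∫ t in Ioi (0:ℝ), Real.exp (-(ν * t)) * |G x t| := fun x =>
    setIntegral_nonneg measurableSet_Ioi fun t _ => mul_nonneg (Real.exp_pos _).le (abs_nonneg _)
  -- (a) `Σ_x (1+x²) ∫ e^{-νt}|G(x,t)| dt < ∞`
  have hB : IntegrableOn (fun t : ℝ => Real.exp (-(ν * t)) * (A * (1 + |t|) ^ m)) (Ioi 0) := by
    refine IntegrableOn.congr_fun ((cli_integrableOn_exp_neg_mul_one_add_pow hν m).const_mul A)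
      (fun t ht => ?_) measurableSet_Ioi
    rw [abs_of_nonneg (le_of_lt ht)]
    ring
  have hS : Summable fun x : ℤ => (1 + (x : ℝ) ^ 2) * ∫ t in Ioi (0:ℝ), Real.exp (-(ν * t)) * |G x t| := by
    refine summable_of_sum_le (c := ∫ t in Ioi (0:ℝ), Real.exp (-(ν * t)) * (A * (1 + |t|) ^ m))
      (fun x => mul_nonneg (by positivity) (hnn x)) fun u => ?_
    calc ∑ x ∈ u, (1 + (x : ℝ) ^ 2) * ∫ t in Ioi (0:ℝ), Real.exp (-(ν * t)) * |G x t|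
        = ∫ t in Ioi (0:ℝ), ∑ x ∈ u, (1 + (x : ℝ) ^ 2) * (Real.exp (-(ν * t)) * |G x t|) := by
          rw [integral_finsetSum _ fun x _ => (hIa x).const_mul _]
          exact Finset.sum_congr rfl fun x _ => (integral_const_mul _ _).symm
      _ ≤ ∫ t in Ioi (0:ℝ), Real.exp (-(ν * t)) * (A * (1 + |t|) ^ m) := by
          refine setIntegral_mono_on (integrable_finsetSum _ fun x _ => (hIa x).const_mul _) hB
            measurableSet_Ioi fun t _ => ?_
          calc ∑ x ∈ u, (1 + (x : ℝ) ^ 2) * (Real.exp (-(ν * t)) * |G x t|)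
              = Real.exp (-(ν * t)) * ∑ x ∈ u, (1 + (x : ℝ) ^ 2) * |G x t| := by
                rw [Finset.mul_sum]
                exact Finset.sum_congr rfl fun x _ => by ring
            _ ≤ Real.exp (-(ν * t)) * (A * (1 + |t|) ^ m) := by
                refine mul_le_mul_of_nonneg_left ?_ (Real.exp_pos _).le
                exact ((hGw t).1.sum_le_tsum u (fun x _ => by positivity)).trans (hGw t).2
  -- (b) `∫ ‖r (e G)‖ ≤ ∫ e |G|` for `|r| ≤ 1`
  have hdom : ∀ (r : ℝ) (x : ℤ), |r| ≤ 1 → ∫ t in Ioi (0:ℝ), ‖r * (Real.exp (-(ν * t)) * G x t)‖ ≤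
      ∫ t in Ioi (0:ℝ), Real.exp (-(ν * t)) * |G x t| := fun r x hr => by
    refine integral_mono_of_nonneg (Eventually.of_forall fun t => norm_nonneg _) (hIa x)
      (Eventually.of_forall fun t => ?_)
    show ‖r * (Real.exp (-(ν * t)) * G x t)‖ ≤ Real.exp (-(ν * t)) * |G x t|
    rw [Real.norm_eq_abs, abs_mul, abs_mul, abs_of_pos (Real.exp_pos _)]
    calc |r| * (Real.exp (-(ν * t)) * |G x t|) ≤ 1 * (Real.exp (-(ν * t)) * |G x t|) :=
          mul_le_mul_of_nonneg_right hr (by positivity)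
      _ = Real.exp (-(ν * t)) * |G x t| := one_mul _
  refine ⟨Summable.of_nonneg_of_le (fun x => by positivity) (fun x => mul_le_mul_of_nonneg_left ?_
    (by positivity)) hS, fun c hc => ?_⟩
  · have h := hdom 1 x (by simp)
    have e : (fun t : ℝ => ‖(1:ℝ) * (Real.exp (-(ν * t)) * G x t)‖) =
        fun t => ‖Real.exp (-(ν * t)) * G x t‖ := funext fun t => by rw [one_mul]
    rw [e] at h
    exact (le_of_eq (Real.norm_eq_abs _).symm).trans ((norm_integral_le_integral_norm _).trans h)
  · have e1 : ∀ t : ℝ, Real.exp (-(ν * t)) * ∑' x : ℤ, c x * G x t =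
        ∑' x : ℤ, c x * (Real.exp (-(ν * t)) * G x t) := by
      intro t
      rw [← tsum_mul_left]
      exact tsum_congr fun x => by ring
    simp_rw [e1]
    rw [← integral_tsum_of_summable_integral_norm (fun x => (hI x).const_mul (c x))
      (Summable.of_nonneg_of_le (fun x => integral_nonneg fun t => norm_nonneg _)
        (fun x => (hdom (c x) x (hc x)).trans (le_mul_of_one_le_left (hnn x)
          (by nlinarith [sq_nonneg (x : ℝ)]))) hS)]
    exact tsum_congr fun x => integral_const_mul _ _

/-! ## Clauses (11) and (12) -/

/-- CLAUSES (11) `χ(k) − f̂_ν(k) = (2 − 2cos k)𝒢_ν(k)/ν` and (12)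
`∫₀^∞e^(−νt)Σ_xG(x,t)dt = (ν/2)(Σ_x x²S̄_ν(x) − Σ_x x²S(x,0))`, at a fixed `ν > 0`, for arbitrary `S, G` with the
listed regularity. [folklore] -/
theorem cli_clauses {S G : ℤ → ℝ → ℝ} (hGc : ∀ x : ℤ, Continuous (G x)) {M : ℝ}
    (hM : ∀ (x : ℤ) (t : ℝ), |G x t| ≤ M) {A : ℝ} {m : ℕ}
    (hGw : ∀ t : ℝ, Summable (fun x : ℤ => (1 + (x : ℝ) ^ 2) * |G x t|) ∧
      (∑' x : ℤ, (1 + (x : ℝ) ^ 2) * |G x t|) ≤ A * (1 + |t|) ^ m)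
    (hS : ∀ (x : ℤ) (t : ℝ), 0 ≤ t →
      S x t - S x 0 = ∫ u in Set.Ioc (0:ℝ) t, (t - u) * (G (x + 1) u - 2 * G x u + G (x - 1) u))
    {ν : ℝ} (hν : 0 < ν)
    (hSb : Summable fun x : ℤ => (1 + (x : ℝ) ^ 2) * |ν * ∫ t in Ioi (0:ℝ), Real.exp (-(ν * t)) * S x t|)
    (hS0 : Summable fun x : ℤ => (1 + (x : ℝ) ^ 2) * |S x 0|) :
    (∀ k : ℝ, (∑' x : ℤ, Real.cos (k * (x : ℝ)) * S x 0) -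
        ∑' x : ℤ, Real.cos (k * (x : ℝ)) * (ν * ∫ t in Ioi (0:ℝ), Real.exp (-(ν * t)) * S x t) =
      (2 - 2 * Real.cos k) *
        (∫ t in Ioi (0:ℝ), Real.exp (-(ν * t)) * ∑' x : ℤ, Real.cos (k * (x : ℝ)) * G x t) / ν) ∧
    ∫ t in Ioi (0:ℝ), Real.exp (-(ν * t)) * ∑' x : ℤ, G x t =
      ν / 2 * ((∑' x : ℤ, (x : ℝ) ^ 2 * (ν * ∫ t in Ioi (0:ℝ), Real.exp (-(ν * t)) * S x t)) -
        ∑' x : ℤ, (x : ℝ) ^ 2 * S x 0) := by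
  have hν0 : ν ≠ 0 := hν.ne'
  set L : ℤ → ℝ := fun y => ∫ t in Ioi (0:ℝ), Real.exp (-(ν * t)) * G y t with hL
  set Sb : ℤ → ℝ := fun x => ν * ∫ t in Ioi (0:ℝ), Real.exp (-(ν * t)) * S x t with hSb_def
  obtain ⟨hLw, hex⟩ := cli_laplace_family hGc hM hGw hν
  have habel : ∀ x : ℤ, Sb x - S x 0 = ν⁻¹ * (L (x + 1) - 2 * L x + L (x - 1)) := fun x =>
    cli_abel_pointwise hGc hM hS hν x
  -- weighted summabilities: `|c a| ≤ (1+x²)|a|` for `|c| ≤ 1 + x²`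
  have hwS : ∀ (c a : ℤ → ℝ), Summable (fun x : ℤ => (1 + (x : ℝ) ^ 2) * |a x|) →
      (∀ x : ℤ, |c x| ≤ 1 + (x : ℝ) ^ 2) → Summable fun x : ℤ => c x * a x := fun c a ha hc =>
    Summable.of_norm_bounded ha fun x => by
      rw [Real.norm_eq_abs, abs_mul]
      exact mul_le_mul_of_nonneg_right (hc x) (abs_nonneg _)
  refine ⟨fun k => ?_, ?_⟩
  · -- clause (11)
    rw [hex (fun x => Real.cos (k * (x : ℝ))) fun x => Real.abs_cos_le_one _]
    have hcw : ∀ y : ℤ, |Real.cos (k * (y : ℝ))| ≤ 1 + (y : ℝ) ^ 2 := fun y =>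
      (Real.abs_cos_le_one _).trans (le_add_of_nonneg_right (sq_nonneg _))
    have hc1 : ∀ (e : ℤ ≃ ℤ) (y : ℤ), |Real.cos (k * (y : ℝ))| ≤ 1 * (1 + ((e y : ℤ) : ℝ) ^ 2) :=
      fun e y => by rw [one_mul]; exact (Real.abs_cos_le_one _).trans (le_add_of_nonneg_right (sq_nonneg _))
    have hL1 : Summable fun x : ℤ => Real.cos (k * (x : ℝ)) * L (x + 1) :=
      cli_summable_mul_shift hLw (Equiv.addRight (1:ℤ)) 1 (hc1 _)
    have hL0 : Summable fun x : ℤ => Real.cos (k * (x : ℝ)) * L x :=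
      cli_summable_mul_shift hLw (Equiv.refl ℤ) 1 (hc1 _)
    have hL2 : Summable fun x : ℤ => Real.cos (k * (x : ℝ)) * L (x - 1) :=
      cli_summable_mul_shift hLw (Equiv.subRight (1:ℤ)) 1 (hc1 _)
    rw [← (hwS _ _ hS0 hcw).tsum_sub (hwS _ _ hSb hcw)]
    calc ∑' x : ℤ, (Real.cos (k * (x : ℝ)) * S x 0 - Real.cos (k * (x : ℝ)) * Sb x)
        = ∑' x : ℤ, -ν⁻¹ * (Real.cos (k * (x : ℝ)) * (L (x + 1) - 2 * L x + L (x - 1))) :=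
          tsum_congr fun x => by rw [← mul_sub, ← neg_sub, habel x]; ring
      _ = -ν⁻¹ * ∑' x : ℤ, (Real.cos (k * ((x - 1 : ℤ) : ℝ)) - 2 * Real.cos (k * (x : ℝ)) +
            Real.cos (k * ((x + 1 : ℤ) : ℝ))) * L x := by
          rw [tsum_mul_left, cli_tsum_mul_laplacian (fun x : ℤ => Real.cos (k * (x : ℝ))) L hL1 hL0 hL2]
      _ = -ν⁻¹ * ∑' x : ℤ, (2 * Real.cos k - 2) * (Real.cos (k * (x : ℝ)) * L x) := by
          congr 1
          refine tsum_congr fun x => ?_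
          push_cast
          linear_combination (L x) * cli_cos_shift_add k (x : ℝ)
      _ = (2 - 2 * Real.cos k) * (∑' x : ℤ, Real.cos (k * (x : ℝ)) * L x) / ν := by
          rw [tsum_mul_left]
          field_simp
          ring
  · -- clause (12)
    have hG1 : ∫ t in Ioi (0:ℝ), Real.exp (-(ν * t)) * ∑' x : ℤ, G x t = ∑' x : ℤ, L x := by
      have h := hex (fun _ => 1) fun _ => by simp
      simp only [one_mul] at h
      exact h
    have hsq : ∀ y : ℤ, |((y : ℤ) : ℝ) ^ 2| ≤ 1 + (y : ℝ) ^ 2 := fun y => by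
      rw [abs_of_nonneg (sq_nonneg _)]; exact le_add_of_nonneg_left zero_le_one
    have hL1 : Summable fun x : ℤ => (x : ℝ) ^ 2 * L (x + 1) :=
      cli_summable_mul_shift hLw (Equiv.addRight (1:ℤ)) 2 fun y => by
        rw [abs_of_nonneg (sq_nonneg _)]
        show ((y : ℤ) : ℝ) ^ 2 ≤ 2 * (1 + (((y + 1 : ℤ)) : ℝ) ^ 2)
        push_cast; nlinarith [sq_nonneg ((y : ℝ) + 2)]
    have hL0 : Summable fun x : ℤ => (x : ℝ) ^ 2 * L x :=
      cli_summable_mul_shift hLw (Equiv.refl ℤ) 2 fun y => by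
        rw [abs_of_nonneg (sq_nonneg _)]
        show ((y : ℤ) : ℝ) ^ 2 ≤ 2 * (1 + ((y : ℤ) : ℝ) ^ 2)
        nlinarith [sq_nonneg (y : ℝ)]
    have hL2 : Summable fun x : ℤ => (x : ℝ) ^ 2 * L (x - 1) :=
      cli_summable_mul_shift hLw (Equiv.subRight (1:ℤ)) 2 fun y => by
        rw [abs_of_nonneg (sq_nonneg _)]
        show ((y : ℤ) : ℝ) ^ 2 ≤ 2 * (1 + (((y - 1 : ℤ)) : ℝ) ^ 2)
        push_cast; nlinarith [sq_nonneg ((y : ℝ) - 2)]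
    have hdiff : (∑' x : ℤ, (x : ℝ) ^ 2 * Sb x) - ∑' x : ℤ, (x : ℝ) ^ 2 * S x 0 = 2 * ν⁻¹ * ∑' x : ℤ, L x := by
      rw [← (hwS _ _ hSb hsq).tsum_sub (hwS _ _ hS0 hsq)]
      calc ∑' x : ℤ, ((x : ℝ) ^ 2 * Sb x - (x : ℝ) ^ 2 * S x 0)
          = ∑' x : ℤ, ν⁻¹ * ((x : ℝ) ^ 2 * (L (x + 1) - 2 * L x + L (x - 1))) :=
            tsum_congr fun x => by rw [← mul_sub, habel x]; ring
        _ = ν⁻¹ * ∑' x : ℤ, ((((x - 1 : ℤ)) : ℝ) ^ 2 - 2 * (x : ℝ) ^ 2 + (((x + 1 : ℤ)) : ℝ) ^ 2) * L x := by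
            rw [tsum_mul_left, cli_tsum_mul_laplacian (fun x : ℤ => ((x : ℤ) : ℝ) ^ 2) L hL1 hL0 hL2]
        _ = ν⁻¹ * ∑' x : ℤ, 2 * L x := by
            congr 1
            refine tsum_congr fun x => ?_
            push_cast
            ring
        _ = 2 * ν⁻¹ * ∑' x : ℤ, L x := by rw [tsum_mul_left]; ring
    rw [hdiff, hG1]
    field_simp

/-! ## The registered stub -/

/-- STUB I `stub_conservationLawIdentities` (registered signature, verbatim; PURE REAL ANALYSIS — `S`, `G` are
arbitrary functions `ℤ → ℝ → ℝ` with the listed regularity): (11) the k-SPACE CONSERVATION LAW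
`χ(k) − f̂_ν(k) = (2−2cos k)𝒢_ν(k)/ν` and (12) HELFAND–ABEL `∫₀^∞e^(−νt)Σ_xG(x,t)dt = (ν/2)(Σ_x x²S̄_ν(x) − Σ_x x²S(x,0))`,
via the pointwise Abel law `S̄_ν(x) − S(x,0) = ν⁻¹(L(x+1) − 2L(x) + L(x−1))` (`cli_abel_pointwise`, `cli_clauses`).
The Laplace-integrability hypothesis on `S` is not needed (it follows from the conservation law). [folklore] -/
theorem stub_conservationLawIdentities :
    ∀ (S G : ℤ → ℝ → ℝ),
    (∀ x : ℤ, Continuous (G x)) →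
    (∃ M : ℝ, ∀ (x : ℤ) (t : ℝ), |G x t| ≤ M) →
    (∃ (A : ℝ) (m : ℕ), ∀ t : ℝ, Summable (fun x : ℤ => (1 + (x : ℝ) ^ 2) * |G x t|) ∧
      (∑' x : ℤ, (1 + (x : ℝ) ^ 2) * |G x t|) ≤ A * (1 + |t|) ^ m) →
    (∀ (x : ℤ) (t : ℝ), 0 ≤ t →
      S x t - S x 0 = ∫ u in Set.Ioc (0:ℝ) t, (t - u) * (G (x + 1) u - 2 * G x u + G (x - 1) u)) →
    (∀ x : ℤ, ∀ ν : ℝ, 0 < ν →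
      IntegrableOn (fun t : ℝ => Real.exp (-(ν * t)) * S x t) (Set.Ioi 0)) →
    ∀ Sb : ℝ → ℤ → ℝ,
      Sb = (fun (ν : ℝ) (x : ℤ) => ν * ∫ t in Set.Ioi (0:ℝ), Real.exp (-(ν * t)) * S x t) →
    (∀ ν : ℝ, 0 < ν → Summable (fun x : ℤ => (1 + (x : ℝ) ^ 2) * |Sb ν x|)) →
    Summable (fun x : ℤ => (1 + (x : ℝ) ^ 2) * |S x 0|) →
    ∀ Gh : ℝ → ℝ → ℝ,
      Gh = (fun (ν k : ℝ) =>
        ∫ t in Set.Ioi (0:ℝ), Real.exp (-(ν * t)) * ∑' x : ℤ, Real.cos (k * (x : ℝ)) * G x t) →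
    ∀ fh : ℝ → ℝ → ℝ, fh = (fun (ν k : ℝ) => ∑' x : ℤ, Real.cos (k * (x : ℝ)) * Sb ν x) →
    ∀ χk : ℝ → ℝ, χk = (fun k : ℝ => ∑' x : ℤ, Real.cos (k * (x : ℝ)) * S x 0) →
    (∀ ν : ℝ, 0 < ν → ∀ k : ℝ, χk k - fh ν k = (2 - 2 * Real.cos k) * Gh ν k / ν) ∧
    (∀ ν : ℝ, 0 < ν → ∫ t in Set.Ioi (0:ℝ), Real.exp (-(ν * t)) * ∑' x : ℤ, G x t =
      ν / 2 * ((∑' x : ℤ, (x : ℝ) ^ 2 * Sb ν x) - ∑' x : ℤ, (x : ℝ) ^ 2 * S x 0)) := by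
  intro S G hGc hGb hGw hS _hSi Sb hSb_def hSbs hS0 Gh hGh_def fh hfh_def χk hχ_def
  obtain ⟨M, hM⟩ := hGb
  obtain ⟨A, m, hAm⟩ := hGw
  subst hSb_def hGh_def hfh_def hχ_def
  exact ⟨fun ν hν k => (cli_clauses hGc hM hAm hS hν (hSbs ν hν) hS0).1 k,
    fun ν hν => (cli_clauses hGc hM hAm hS hν (hSbs ν hν) hS0).2⟩

end Summit.AtomisticToContinuum.FouriersLaw.Theorems.FibreCalculusSketch

end
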